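import Literature.Probability.RandomPlanarGeometry.PlusHullDisplacement
import Literature.Probability.RandomPlanarGeometry.HydrodynamicMaps
import HarnessLib

/-!
# The hydrodynamically normalized map `g_A` and the half-plane capacity of a `+`-hull

G. F. Lawler, *Conformally Invariant Processes in the Plane*, AMS (2005), §3.4, Prop. 3.36: for a
bounded hull `A`, `g_A : ℍ ∖ A → ℍ` is the conformal transformation with `g_A(z) - z → 0` at
`∞`; [LSW] (Lawler–Schramm–Werner, *Conformal restriction: the chordal case* (2003), §2) use
instead `Φ_A = g_A - g_A(0)`. The tree constructs `Φ_A` for nonempty `A ∈ 𝒬₊` together with its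
Schwarz reflection `E_A` (`PlusHullExtension`: `IsPlusHull.baseMap`, `IsPlusHull.extMap`, with
`E_A(z) - z → L ∈ ℝ`, `IsPlusHull.exists_tendsto_extMap_sub`; the constant `L = L_A` is
`IsPlusHull.extShift` of `PlusHullDisplacement`, where `|g_A(z) - z| ≤ 6r` is proved for
`g_A = E_A - L_A`). Here we merely bundle the shifted map as a conformal equivalence:

* `IsPlusHull.hydroMap` — **`g_A = Φ_A - L_A : ℍ ∖ A → ℍ`**, a conformal equivalence with the
  hydrodynamic normalization (`isHydrodynamicMap_hydroMap`), so that the abstract theory of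
  `HydrodynamicMaps` (`Im g_A ≤ Im`, reflection, `hcap`, Prop. 3.46, quotient maps) applies to
  every nonempty `A ∈ 𝒬₊`; in particular **`hcap(A) > 0`** (`hcap_hydroMap_pos`, Lawler's
  (3.8)), `hcap(A) ≤ 288 rad(A)²` (`hcap_hydroMap_le`, (3.9)) and `|g_A(z) - z| ≤ 6 rad`
  (`norm_hydroMap_sub_self_le`, from `IsPlusHull.norm_extMap_sub_extShift_sub_le`).

## References

* G. F. Lawler, *Conformally Invariant Processes in the Plane* (2005), §3.4 Prop. 3.36,
  Def. 3.37, (3.8)–(3.9). [Lawler2005]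
* G. F. Lawler, O. Schramm, W. Werner, *Conformal restriction: the chordal case* (2003), §2
  (`Φ_A = g_A - g_A(0)`). [LawlerSchrammWerner2003Restriction]
-/

noncomputable section

open Set Filter Topology Metric Bornology Complex
open UpperHalfPlane (upperHalfPlaneSet isOpen_upperHalfPlaneSet)

namespace Literature.Probability.RandomPlanarGeometry

namespace IsPlusHull

variable {A : Set ℂ} (hA : IsPlusHull A) (hne : A.Nonempty)
include hA hne

/-- **The hydrodynamically normalized map `g_A = Φ_A - L_A : ℍ ∖ A → ℍ`** of a nonempty
`A ∈ 𝒬₊` (Lawler (2005), Prop. 3.36). [cite: Lawler2005, §3.4 Prop. 3.36] -/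
def hydroMap : ConformalEquiv (upperHalfPlaneSet \ A) upperHalfPlaneSet :=
  (hA.baseMap hne).trans (addRealUpperHalfPlane (-hA.extShift hne))

/-- `g_A(z) = Φ_A(z) - L_A`. [folklore] -/
@[simp] theorem hydroMap_apply (z : ℂ) : hA.hydroMap hne z = hA.baseMap hne z - hA.extShift hne := by
  simp [hydroMap, sub_eq_add_neg]

/-- `g_A⁻¹(w) = Φ_A⁻¹(w + L_A)`. [folklore] -/
@[simp] theorem hydroMap_symm_apply (w : ℂ) :
    (hA.hydroMap hne).symm w = (hA.baseMap hne).symm (w + hA.extShift hne) := by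
  show (hA.baseMap hne).symm ((addRealUpperHalfPlane (-hA.extShift hne)).symm w) = _
  congr 1
  show w - ((-hA.extShift hne : ℝ) : ℂ) = w + hA.extShift hne
  push_cast; ring

/-- `g_A(z) = E_A(z) - L_A` on `ℍ ∖ A`. [folklore] -/
theorem hydroMap_eq_extMap_sub {z : ℂ} (hz : z ∈ upperHalfPlaneSet \ A) :
    hA.hydroMap hne z = hA.extMap hne z - hA.extShift hne := by
  rw [hydroMap_apply, hA.extMap_of_mem_diff hne hz]

/-- **`g_A` is hydrodynamically normalized**: `g_A(z) - z → 0` at `∞` in `ℍ ∖ A`. [cite: Lawler2005, §3.4 Prop. 3.36] -/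
theorem isHydrodynamicMap_hydroMap : IsHydrodynamicMap A (hA.hydroMap hne) := by
  unfold IsHydrodynamicMap
  have h1 : Tendsto (fun z ↦ hA.extMap hne z - z - hA.extShift hne) (cocompact ℂ) (𝓝 0) := by
    have := (hA.tendsto_extMap_sub_extShift hne).sub_const (hA.extShift hne : ℂ)
    rwa [sub_self] at this
  refine (h1.mono_left inf_le_left).congr' ?_
  filter_upwards [mem_inf_of_right (mem_principal_self _)] with z hz
  rw [hA.hydroMap_eq_extMap_sub hne hz]
  ring

omit hne in
/-- `A ∩ ℍ` is bounded. [folklore] -/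
theorem isBounded_inter_upperHalfPlaneSet : IsBounded (A ∩ upperHalfPlaneSet) :=
  hA.1.isBoundedHull.isCompact.isBounded.subset inter_subset_left

/-- **`hcap(A) > 0`** for a nonempty `A ∈ 𝒬₊` (Lawler (2005), (3.8)). [cite: Lawler2005, §3.4 (3.8)] -/
theorem hcap_hydroMap_pos : 0 < hcap A (hA.hydroMap hne) :=
  (hA.isHydrodynamicMap_hydroMap hne).hcap_pos hA.isBounded_inter_upperHalfPlaneSet
    (hA.inter_upperHalfPlaneSet_nonempty hne)

/-- **`hcap(A) ≤ 288 r²`** when `A ⊆ B̄(x, r)`, `x ∈ ℝ` (Lawler (2005), (3.9), weaker constant). [cite: Lawler2005, §3.4 (3.9)] -/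
theorem hcap_hydroMap_le {x r : ℝ} (hr : 0 < r) (h : A ⊆ closedBall (x : ℂ) r) :
    hcap A (hA.hydroMap hne) ≤ 288 * r ^ 2 :=
  (hA.isHydrodynamicMap_hydroMap hne).hcap_le (fun _ hz ↦ h hz.1) hr

/-- **`|g_A(z) - z| ≤ 6 r`** on `ℍ ∖ A` when `A ⊆ B̄(x, r)`, `x ∈ ℝ` (Lawler (2005), (3.12);
`PlusHullDisplacement`). [cite: Lawler2005, §3.4 (3.12)] -/
theorem norm_hydroMap_sub_self_le {x r : ℝ} (hr : 0 < r) (h : A ⊆ closedBall (x : ℂ) r) {z : ℂ}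
    (hz : z ∈ upperHalfPlaneSet \ A) : ‖hA.hydroMap hne z - z‖ ≤ 6 * r := by
  rw [hA.hydroMap_eq_extMap_sub hne hz]
  exact hA.norm_extMap_sub_extShift_sub_le hne hr h (hA.diff_subset_plusDomain hz)

/-- **`Im g_A(z) ≤ Im z`** on `ℍ ∖ A`. [cite: Lawler2005, §3.4 (3.7)] -/
theorem hydroMap_im_le {z : ℂ} (hz : z ∈ upperHalfPlaneSet \ A) : (hA.hydroMap hne z).im ≤ z.im :=
  (hA.isHydrodynamicMap_hydroMap hne).im_le hA.isBounded_inter_upperHalfPlaneSet hz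

end IsPlusHull

end Literature.Probability.RandomPlanarGeometry
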